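/-
Copyright (c) 2026 the pub-hodgecm-mathlib formalisation cell (harness21).  Prover seat hodgecm-mathlib-K2Liu-p12 (g5), Track B «K2-LIT»,
#184♮ = hLiu418 = `stmt-HodgeConjecture-24832`; #42S BLOCK D row D-2 — THE ALGEBRAIC ROAD: `hbad` from a quasi-invariant FUNCTIONAL presentation of the bad factor
and the EMPTY FIBRE of the line's Gram (★ U2c `K2LiuRankOneLineGram` §1), no ball ∕ Karel ∕ Schrödinger-telescope letter (block-D desk word #3, 2026-09-05).
THEOREMS ONLY (no `def`, no `instance`, no `notation`, no named-fact hypothesis, no `sorry`).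
-/
import Summits.HodgeConjecture.HodgeConjecture.Theorems.K2LiuRankOneLineGram                  -- ★ U2c `exists_forall_eq_of_functional_ne_zero` (twisted partition trick, model-free)
import Summits.HodgeConjecture.HodgeConjecture.Theorems.K2LiuIncoherentDeadPlacesBadRow       -- ★ p862742 (the #42S frame; `hbad` binder bytes)
import Literature.NumberTheory.Automorphic.AdeleAddCharLocalNontrivial                      -- ★ `isContinuousNontrivial_adeleAddCharAt` (`ψ_v ≠ 1`)
import HarnessLib

/-!
# Crux `HLiu418`, #42S BLOCK D, row D-2 — THE ALGEBRAIC ROAD TO `hbad`: a dead bad place kills every face's bad factor because the factor is a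
# `ψ_{β′}`-QUASI-INVARIANT FUNCTIONAL of the complementary line's local Weil vector and the line's Gram MISSES `β′` ([KudlaRallis1994, §3]; ★ U2c)

Cell `hodgecm-mathlib`, crux item hLiu418 = `stmt-HodgeConjecture-24832` (helper lane `--supports stmt-HodgeConjecture-24832 --as helper`, count-neutral; closes no socket);
route of record `HCCMUnconditional`; squad K2 ∕ K2Liu; block-D desk K2Liu-p12 (g5) (chair K2-lead (g2) VALVE 2026-09-05T00:19:37Z), line desk K2E5-p16 (g8), LEAD F0P6-plan (g15);
box K2Liu-audit1.  Companion of ★ p863165 ∕ p863405 ∕ p863462 ∕ p863521 (the BALL road) and of K2Liu-p25 (g3)'s `K2LiuIncoherentRankOneBadPlaceDichotomy` (the fibre letter).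

WHY A SECOND ROAD (K2Liu-p25 (g3) census 2026-09-05T00:29:23Z, adopted in desk word #2).  The BALL road reads the bad factor as a ball average of ★ W1-fin's twisted SW word and
kills it by oscillation off the orbit — which needs the phase form to MISS `β′` on the support of the test vector; in ★ W1-fin's (2+2) model that form is a universal QUATERNARY
form (O'Meara 63:18), so the support letter `hΨ` is not dischargeable from deadness, and the rank-2 model `(1+1)` where it is costs a four-file Schrödinger telescope
((BR-N)₁, (BR-W)₁, W1-fin-b₁, W1-fin §2₁ — F0P2-p11 (g3) census 00:30:43Z).  The mathematics of [KudlaRallis1994, §3] is ALGEBRAIC and already ★ in model-free form: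
★ U2c `K2LiuRankOneLineGram.exists_forall_eq_of_functional_ne_zero` — if a group `Z` acts on `𝒮(X)` by locally constant unitary MULTIPLIERS `u_z` and a NON-ZERO linear
functional `Λ` is `χ`-quasi-invariant (`Λ(ρ_z φ) = χ(z)·Λ φ`), then some point `x` has `u_z(x) = χ(z)` for all `z` (the twisted partition trick).  With the Siegel unipotent of the
rank-one doubled line acting on the line's local Weil vector by `u_z(x) = ψ_v(b(z)·G(x))` (`G` = the line's Gram ∕ norm form in the model, `b` filling `L⁺_v`) and
`χ(z) = ψ_v(b(z)·β′)`, a fixed point means `G(x) = β′` (§1 `eq_of_forall_addChar_mul_eq`: `ψ_v ≠ 1` separates).  So: **bad factor `W = cW·Λ(Φ)` with `Λ` quasi-invariant, and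
`G` misses `β′` at a dead place ⇒ `Λ = 0` ⇒ `W = 0`** — no evaluation at `0`, no Weyl word, no ball, no support hypothesis on `Φ`.
* §1 `eq_of_forall_addChar_mul_eq` (`(∀ t, ψ(t·g) = ψ(t·β)) ⇒ g = β` for `ψ ≠ 1`), **`functional_eq_zero_of_forall_ne`** (the one-place engine over ★ U2c), `mul_functional_apply_eq_zero_of_forall_ne`.
* §2 **`hbad_faces_of_lineFunctional`** — the `hbad` binder of ★ p863475 `K2LiuIncoherentRankOneBlockDFaces.hdead_of_facePresentations_rows` (∕ ★ p863053) BYTES VERBATIM from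
  BY-VALUE local model data per `(X, v)` (space `Xsp v`, group `Zg v`, representation `ρ X v`, parameter map `bz X v` onto `L⁺_v`, Gram values `Gm X v`, multiplier law `hρ`,
  local constancy `hu`), the Whittaker parameter `β′ X v` with its character `χq X v` (`hχ`), the functionals `Λ X j h i v` with quasi-invariance `hΛ`, the vectors `Φ X j h i v`,
  the PRESENTATION `hWfun : W X j h i v = cW X j h i v · Λ X j h i v (Φ X j h i v)` ((K1a-3) `hWfac` ∘ the seam: Karel's regularised Whittaker functional of the line's SW
  section IS such a `Λ`, quasi-invariance = change of variables), and the FIBRE letter `hfibre : dead ⇒ ∀ x, Gm X v x ≠ β′ X v` (K2Liu-p25 (g3)'s (B)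
  `halfForm_cOfFix_nElem_ne_of_hilbertSymbol` in the rank-2 model: `Gm = (im τ)·a_v·N`, empty fibre ⟺ the Hilbert test fails); **`hbad_of_lineFunctional`** — the one-face twin
  (★ p862742's `hbad` binder, `Tf X`).
* §3 (ED. 2, append-only) **`hWfac_faces_of_lineFunctional`**, **`hV_faces_of_lineFunctional`** — the SAME road poured into the four BALL slots `cW V hWfac hV` of ★ p863475 ∕
  ★ p863507 (`V … k := Λ(Φ)` constant in `k`, `k₀ = 0`), so the tie keeps its slots.
[KudlaRallis1994, §3] [Rallis1984, §4] [MoeglinVignerasWaldspurger1987, Chap. 2 II.6, Chap. 3 IV] [KudlaSweet1997, §1].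
HONEST LABEL.  Count-neutral helper; `HC_CM` is proved only modulo the 7 printed citations (2 remaining named inputs: hLiu418 = `stmt-HodgeConjecture-24832`,
h413 = `stmt-HodgeConjecture-24833`) until rung 0 closes.  This file closes no socket and chooses nothing for the constructor: the local model, `Λ`, `Φ`, `hWfun`, `hΛ`, `hfibre`
enter BY VALUE (the multiplier law `hρ` at the constructor's model is ★ (BR-N) §1 `exists_section_iotaD_nElem_apply_eq_smul_conj_unipOpPi`-type, n-generic).

## References
* [KudlaRallis1994] S. Kudla, S. Rallis, *A regularized Siegel–Weil formula: the first term identity*, Ann. of Math. 140 (1994), §3.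
* [Rallis1984] S. Rallis, *On the Howe duality conjecture*, Compositio Math. 51 (1984), §4.
* [MoeglinVignerasWaldspurger1987] C. Mœglin, M.-F. Vignéras, J.-L. Waldspurger, LNM 1291 (1987), Chap. 2 II.6, Chap. 3 IV.
* [KudlaSweet1997] S. S. Kudla, W. J. Sweet, *Degenerate principal series representations for U(n,n)*, Israel J. Math. 98 (1997), §1.
-/

set_option autoImplicit false
set_option linter.dupNamespace false -- the mandated namespace repeats `HodgeConjecture.HodgeConjecture`

noncomputable section

open scoped Matrix
open NumberField IsDedekindDomain
open Literature.NumberTheory.QuadraticForms Literature.NumberTheory.Automorphic Literature.NumberTheory.Automorphic.UnitaryGroup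
open Literature.NumberTheory.GaloisRepresentations Literature.RepresentationTheory
open Literature.NumberTheory.GelbartRogawski1991 Literature.NumberTheory.GelbartRogawski1991.GRConstruction

namespace Summit.HodgeConjecture.HodgeConjecture.Cruxes.HLiu418.K2LiuIncoherentRankOneBadPlaceFunctionalRow

open K2LiuSiegelUnipotentFourierDefs
open K2LiuRankOneLineGram (exists_forall_eq_of_functional_ne_zero)

/-! ## §1 One place: a quasi-invariant functional vanishes when the Gram misses the parameter -/

section OnePlace

variable {F : Type*} [Field F] (ψ : AddChar F Circle)

/-- **`ψ ≠ 1` separates**: if `ψ(t·g) = ψ(t·β)` for every `t`, then `g = β` (take `t := a·(g − β)⁻¹` with `ψ a ≠ 1`). [folklore] -/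
theorem eq_of_forall_addChar_mul_eq (hψ : ∃ a, ψ a ≠ 1) {g β : F} (h : ∀ t : F, ψ (t * g) = ψ (t * β)) : g = β := by
  by_contra hne
  obtain ⟨a, ha⟩ := hψ
  have hsub : g - β ≠ 0 := sub_ne_zero.2 hne
  have ha' : a = (a * (g - β)⁻¹) * g + -((a * (g - β)⁻¹) * β) := by
    rw [← sub_eq_add_neg, ← mul_sub, inv_mul_cancel_right₀ hsub]
  have key : ψ a = 1 := by
    rw [ha', AddChar.map_add_eq_mul, AddChar.map_neg_eq_inv, h, mul_inv_cancel]
  exact ha key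

variable {X : Type*} [TopologicalSpace X] {Z : Type*} [Group Z]

/-- **THE ONE-PLACE ENGINE** ([KudlaRallis1994, §3] via ★ U2c): a group `Z` acting on `𝒮(X)` by the locally constant multipliers `x ↦ ψ(b(z)·G(x))` (`b` onto `F`), a linear
functional `Λ` quasi-invariant for `χ(z) = ψ(b(z)·β)`, and a Gram map `G` that MISSES `β` ⇒ `Λ = 0`. [cite: KudlaRallis1994, §3] [cite: Rallis1984, §4] -/
theorem functional_eq_zero_of_forall_ne (hψ : ∃ a, ψ a ≠ 1) (ρ : Representation ℂ Z ↥(SchwartzBruhat X)) (b : Z → F) (hb : ∀ t, ∃ z, b z = t)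
    (G : X → F) (β : F) (hu : ∀ z, IsLocallyConstant fun x => ((ψ (b z * G x) : Circle) : ℂ))
    (hρ : ∀ (z : Z) (φ : ↥(SchwartzBruhat X)), ((ρ z φ : ↥(SchwartzBruhat X)) : X → ℂ) = (fun x => ((ψ (b z * G x) : Circle) : ℂ)) * φ)
    (χ : Z →* ℂˣ) (hχ : ∀ z, ((χ z : ℂˣ) : ℂ) = ((ψ (b z * β) : Circle) : ℂ))
    {M : Type*} [AddCommGroup M] [Module ℂ M] (Λ : ↥(SchwartzBruhat X) →ₗ[ℂ] M) (hΛ : ∀ (z : Z) (φ : ↥(SchwartzBruhat X)), Λ (ρ z φ) = ((χ z : ℂˣ) : ℂ) • Λ φ)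
    (hfibre : ∀ x, G x ≠ β) : Λ = 0 := by
  by_contra hΛ0
  obtain ⟨x, hx⟩ := exists_forall_eq_of_functional_ne_zero ρ (fun z x => ((ψ (b z * G x) : Circle) : ℂ)) hu hρ χ Λ hΛ hΛ0
  refine hfibre x (eq_of_forall_addChar_mul_eq ψ hψ fun t => ?_)
  obtain ⟨z, rfl⟩ := hb t
  have h1 : ((ψ (b z * G x) : Circle) : ℂ) = ((ψ (b z * β) : Circle) : ℂ) := by rw [← hχ z]; exact hx z
  exact Circle.ext h1

/-- … hence a factor PRESENTED as `c · Λ φ` vanishes. [cite: KudlaRallis1994, §3] -/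
theorem mul_functional_apply_eq_zero_of_forall_ne (hψ : ∃ a, ψ a ≠ 1) (ρ : Representation ℂ Z ↥(SchwartzBruhat X)) (b : Z → F) (hb : ∀ t, ∃ z, b z = t)
    (G : X → F) (β : F) (hu : ∀ z, IsLocallyConstant fun x => ((ψ (b z * G x) : Circle) : ℂ))
    (hρ : ∀ (z : Z) (φ : ↥(SchwartzBruhat X)), ((ρ z φ : ↥(SchwartzBruhat X)) : X → ℂ) = (fun x => ((ψ (b z * G x) : Circle) : ℂ)) * φ)
    (χ : Z →* ℂˣ) (hχ : ∀ z, ((χ z : ℂˣ) : ℂ) = ((ψ (b z * β) : Circle) : ℂ))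
    (Λ : ↥(SchwartzBruhat X) →ₗ[ℂ] ℂ) (hΛ : ∀ (z : Z) (φ : ↥(SchwartzBruhat X)), Λ (ρ z φ) = ((χ z : ℂˣ) : ℂ) • Λ φ)
    (hfibre : ∀ x, G x ≠ β) (c : ℂ) (φ : ↥(SchwartzBruhat X)) : c * Λ φ = 0 := by
  rw [functional_eq_zero_of_forall_ne ψ hψ ρ b hb G β hu hρ χ hχ Λ hΛ hfibre, LinearMap.zero_apply, mul_zero]

end OnePlace

/-! ## §2 Row D-2 by the algebraic road: the `hbad` binders of ★ p863475 (faces) and ★ p862742 (one face) -/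

section Row

variable (L : Type) [Field L] [NumberField L] [IsCMField L]
variable {N M n : ℕ} (e : Fin N × Fin M ≃ Fin n)
  (dV : Fin N → L) (hdV : ∀ i, IsCMField.complexConj L (dV i) = dV i)
  (dW : Fin M → L) (hdW : ∀ i, IsCMField.complexConj L (dW i) = dW i)

variable {ι : skewMatrices ((IsCMField.complexConj L : L ≃ₐ[Fp L] L) : L →+* L) ((gramR L e dV hdV dW hdW).map (algebraMap (Fp L) L)) → Type}

omit [IsCMField L] in
/-- `ψ_v ≠ 1` in the shape §1 wants. [cite: CasselsFrohlichANT1967, Ch. XV (Tate), Lemma 2.2.3] -/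
theorem exists_adeleAddCharAt_apply_ne_one (v : HeightOneSpectrum (𝓞 ↥(maximalRealSubfield L))) : ∃ a, adeleAddCharAt ↥(maximalRealSubfield L) v a ≠ 1 :=
  AddChar.ne_zero_iff.1 (isContinuousNontrivial_adeleAddCharAt ↥(maximalRealSubfield L) v).2

/-- **ROW D-2, ALGEBRAIC ROAD, FACES** — the `hbad` binder of ★ p863475 `hdead_of_facePresentations_rows` BYTES VERBATIM.  BY VALUE per `(X, v)`: the local model (`Xsp v`,
`Zg v`, `ρ X v`, `bz X v` onto `L⁺_v`, Gram values `Gm X v`, multiplier law `hρ`, local constancy `hu`), the parameter `β′ X v` with `χq X v` (`hχ`); per `(X, j, h, i, v)`: the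
functional `Λ` (quasi-invariance `hΛ`) and the vector `Φ`; the PRESENTATION `hWfun` (bad factor `= cW · Λ Φ`) and the FIBRE letter `hfibre` (dead place ⇒ `Gm X v` misses
`β′ X v`).  Then every face's bad factor dies at a dead bad place (§1). [cite: KudlaRallis1994, §3] [cite: Rallis1984, §4] [cite: MoeglinVignerasWaldspurger1987, Chap. 3 IV] -/
theorem hbad_faces_of_lineFunctional {φ : Type*}
    (S₁ : Finset (HeightOneSpectrum (𝓞 ↥(maximalRealSubfield L))))
    (val : Matrix (Fin n) (Fin n) L → ↥(maximalRealSubfield L))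
    (I : ∀ X : skewMatrices ((IsCMField.complexConj L : L ≃ₐ[Fp L] L) : L →+* L) ((gramR L e dV hdV dW hdW).map (algebraMap (Fp L) L)),
      ι X → HA L e dV hdV dW hdW → Finset φ)
    (Tf : ∀ X : skewMatrices ((IsCMField.complexConj L : L ≃ₐ[Fp L] L) : L →+* L) ((gramR L e dV hdV dW hdW).map (algebraMap (Fp L) L)),
      ι X → HA L e dV hdV dW hdW → Finset (HeightOneSpectrum (𝓞 ↥(maximalRealSubfield L))))
    (W cW : ∀ X : skewMatrices ((IsCMField.complexConj L : L ≃ₐ[Fp L] L) : L →+* L) ((gramR L e dV hdV dW hdW).map (algebraMap (Fp L) L)),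
      ι X → HA L e dV hdV dW hdW → φ → HeightOneSpectrum (𝓞 ↥(maximalRealSubfield L)) → ℂ)
    -- the local model at each bad place (BY VALUE): space, group, representation by multipliers `ψ_v(bz z · Gm x)`
    {Xsp : HeightOneSpectrum (𝓞 ↥(maximalRealSubfield L)) → Type*} [∀ v, TopologicalSpace (Xsp v)] {Zg : HeightOneSpectrum (𝓞 ↥(maximalRealSubfield L)) → Type*} [∀ v, Group (Zg v)]
    (ρ : skewMatrices ((IsCMField.complexConj L : L ≃ₐ[Fp L] L) : L →+* L) ((gramR L e dV hdV dW hdW).map (algebraMap (Fp L) L)) → ∀ v : HeightOneSpectrum (𝓞 ↥(maximalRealSubfield L)), Representation ℂ (Zg v) ↥(SchwartzBruhat (Xsp v)))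
    (bz : skewMatrices ((IsCMField.complexConj L : L ≃ₐ[Fp L] L) : L →+* L) ((gramR L e dV hdV dW hdW).map (algebraMap (Fp L) L)) → ∀ v : HeightOneSpectrum (𝓞 ↥(maximalRealSubfield L)), Zg v → v.adicCompletion ↥(maximalRealSubfield L)) (hbz : ∀ X v t, ∃ z, bz X v z = t)
    (Gm : skewMatrices ((IsCMField.complexConj L : L ≃ₐ[Fp L] L) : L →+* L) ((gramR L e dV hdV dW hdW).map (algebraMap (Fp L) L)) → ∀ v : HeightOneSpectrum (𝓞 ↥(maximalRealSubfield L)), Xsp v → v.adicCompletion ↥(maximalRealSubfield L))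
    (hu : ∀ X v z, IsLocallyConstant fun x => ((adeleAddCharAt ↥(maximalRealSubfield L) v (bz X v z * Gm X v x) : Circle) : ℂ))
    (hρ : ∀ X v (z : Zg v) (φ' : ↥(SchwartzBruhat (Xsp v))),
      ((ρ X v z φ' : ↥(SchwartzBruhat (Xsp v))) : Xsp v → ℂ) = (fun x => ((adeleAddCharAt ↥(maximalRealSubfield L) v (bz X v z * Gm X v x) : Circle) : ℂ)) * φ')
    -- the Whittaker parameter and its character
    (β' : skewMatrices ((IsCMField.complexConj L : L ≃ₐ[Fp L] L) : L →+* L) ((gramR L e dV hdV dW hdW).map (algebraMap (Fp L) L)) → ∀ v : HeightOneSpectrum (𝓞 ↥(maximalRealSubfield L)), v.adicCompletion ↥(maximalRealSubfield L))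
    (χq : skewMatrices ((IsCMField.complexConj L : L ≃ₐ[Fp L] L) : L →+* L) ((gramR L e dV hdV dW hdW).map (algebraMap (Fp L) L)) → ∀ v : HeightOneSpectrum (𝓞 ↥(maximalRealSubfield L)), Zg v →* ℂˣ)
    (hχ : ∀ X v z, ((χq X v z : ℂˣ) : ℂ) = ((adeleAddCharAt ↥(maximalRealSubfield L) v (bz X v z * β' X v) : Circle) : ℂ))
    -- the functionals, their quasi-invariance, the vectors, the presentation of the bad factor
    (Λ : ∀ X : skewMatrices ((IsCMField.complexConj L : L ≃ₐ[Fp L] L) : L →+* L) ((gramR L e dV hdV dW hdW).map (algebraMap (Fp L) L)),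
      ι X → HA L e dV hdV dW hdW → φ → ∀ v : HeightOneSpectrum (𝓞 ↥(maximalRealSubfield L)), ↥(SchwartzBruhat (Xsp v)) →ₗ[ℂ] ℂ)
    (hΛ : ∀ X j h i v (z : Zg v) (φ' : ↥(SchwartzBruhat (Xsp v))), Λ X j h i v (ρ X v z φ') = ((χq X v z : ℂˣ) : ℂ) • Λ X j h i v φ')
    (Φ : ∀ X : skewMatrices ((IsCMField.complexConj L : L ≃ₐ[Fp L] L) : L →+* L) ((gramR L e dV hdV dW hdW).map (algebraMap (Fp L) L)),
      ι X → HA L e dV hdV dW hdW → φ → ∀ v : HeightOneSpectrum (𝓞 ↥(maximalRealSubfield L)), ↥(SchwartzBruhat (Xsp v)))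
    (hWfun : ∀ X : skewMatrices ((IsCMField.complexConj L : L ≃ₐ[Fp L] L) : L →+* L) ((gramR L e dV hdV dW hdW).map (algebraMap (Fp L) L)),
      (X : Matrix (Fin n) (Fin n) L) ≠ 0 → (X : Matrix (Fin n) (Fin n) L).det = 0 → ∀ (j : ι X) (h : HA L e dV hdV dW hdW), ∀ i ∈ I X j h, ∀ v ∈ Tf X j h,
      W X j h i v = cW X j h i v * Λ X j h i v (Φ X j h i v))
    -- the FIBRE letter: at a dead bad place the line's Gram misses the parameter
    (hfibre : ∀ X : skewMatrices ((IsCMField.complexConj L : L ≃ₐ[Fp L] L) : L →+* L) ((gramR L e dV hdV dW hdW).map (algebraMap (Fp L) L)),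
      (X : Matrix (Fin n) (Fin n) L) ≠ 0 → (X : Matrix (Fin n) (Fin n) L).det = 0 → ∀ (j : ι X) (h : HA L e dV hdV dW hdW), ∀ v ∈ Tf X j h,
      ¬ (hilbertSymbol (v.adicCompletion ↥(maximalRealSubfield L)) (algebraMap ↥(maximalRealSubfield L) _ (val X))
          (algebraMap ↥(maximalRealSubfield L) _ (cmQuadraticGenerator L : ↥(maximalRealSubfield L))) = -1 ↔ v ∈ S₁) →
      ∀ x, Gm X v x ≠ β' X v) :
    ∀ X : skewMatrices ((IsCMField.complexConj L : L ≃ₐ[Fp L] L) : L →+* L) ((gramR L e dV hdV dW hdW).map (algebraMap (Fp L) L)),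
      (X : Matrix (Fin n) (Fin n) L) ≠ 0 → (X : Matrix (Fin n) (Fin n) L).det = 0 → ∀ (j : ι X) (h : HA L e dV hdV dW hdW), ∀ i ∈ I X j h, ∀ v ∈ Tf X j h,
      ¬ (hilbertSymbol (v.adicCompletion ↥(maximalRealSubfield L)) (algebraMap ↥(maximalRealSubfield L) _ (val X))
          (algebraMap ↥(maximalRealSubfield L) _ (cmQuadraticGenerator L : ↥(maximalRealSubfield L))) = -1 ↔ v ∈ S₁) → W X j h i v = 0 := by
  intro X hX0 hdet j h i hi v hv hdead
  rw [hWfun X hX0 hdet j h i hi v hv]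
  exact mul_functional_apply_eq_zero_of_forall_ne (adeleAddCharAt ↥(maximalRealSubfield L) v) (exists_adeleAddCharAt_apply_ne_one L v) (ρ X v) (bz X v) (hbz X v)
    (Gm X v) (β' X v) (hu X v) (hρ X v) (χq X v) (hχ X v) (Λ X j h i v) (hΛ X j h i v) (hfibre X hX0 hdet j h v hv hdead) _ _

/-- **ROW D-2, ALGEBRAIC ROAD, ONE FACE** — the `hbad` binder of ★ p862742 `hbad_of_ballLetters` ∕ `hdead_of_presentations` (bad sets `Tf X`, factors `W X j h v`) from the
same letters without the face index. [cite: KudlaRallis1994, §3] [cite: Rallis1984, §4] -/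
theorem hbad_of_lineFunctional
    (S₁ : Finset (HeightOneSpectrum (𝓞 ↥(maximalRealSubfield L))))
    (val : Matrix (Fin n) (Fin n) L → ↥(maximalRealSubfield L))
    (Tf : skewMatrices ((IsCMField.complexConj L : L ≃ₐ[Fp L] L) : L →+* L) ((gramR L e dV hdV dW hdW).map (algebraMap (Fp L) L)) → Finset (HeightOneSpectrum (𝓞 ↥(maximalRealSubfield L))))
    (W cW : ∀ X : skewMatrices ((IsCMField.complexConj L : L ≃ₐ[Fp L] L) : L →+* L) ((gramR L e dV hdV dW hdW).map (algebraMap (Fp L) L)),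
      ι X → HA L e dV hdV dW hdW → HeightOneSpectrum (𝓞 ↥(maximalRealSubfield L)) → ℂ)
    {Xsp : HeightOneSpectrum (𝓞 ↥(maximalRealSubfield L)) → Type*} [∀ v, TopologicalSpace (Xsp v)] {Zg : HeightOneSpectrum (𝓞 ↥(maximalRealSubfield L)) → Type*} [∀ v, Group (Zg v)]
    (ρ : skewMatrices ((IsCMField.complexConj L : L ≃ₐ[Fp L] L) : L →+* L) ((gramR L e dV hdV dW hdW).map (algebraMap (Fp L) L)) → ∀ v : HeightOneSpectrum (𝓞 ↥(maximalRealSubfield L)), Representation ℂ (Zg v) ↥(SchwartzBruhat (Xsp v)))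
    (bz : skewMatrices ((IsCMField.complexConj L : L ≃ₐ[Fp L] L) : L →+* L) ((gramR L e dV hdV dW hdW).map (algebraMap (Fp L) L)) → ∀ v : HeightOneSpectrum (𝓞 ↥(maximalRealSubfield L)), Zg v → v.adicCompletion ↥(maximalRealSubfield L)) (hbz : ∀ X v t, ∃ z, bz X v z = t)
    (Gm : skewMatrices ((IsCMField.complexConj L : L ≃ₐ[Fp L] L) : L →+* L) ((gramR L e dV hdV dW hdW).map (algebraMap (Fp L) L)) → ∀ v : HeightOneSpectrum (𝓞 ↥(maximalRealSubfield L)), Xsp v → v.adicCompletion ↥(maximalRealSubfield L))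
    (hu : ∀ X v z, IsLocallyConstant fun x => ((adeleAddCharAt ↥(maximalRealSubfield L) v (bz X v z * Gm X v x) : Circle) : ℂ))
    (hρ : ∀ X v (z : Zg v) (φ' : ↥(SchwartzBruhat (Xsp v))),
      ((ρ X v z φ' : ↥(SchwartzBruhat (Xsp v))) : Xsp v → ℂ) = (fun x => ((adeleAddCharAt ↥(maximalRealSubfield L) v (bz X v z * Gm X v x) : Circle) : ℂ)) * φ')
    (β' : skewMatrices ((IsCMField.complexConj L : L ≃ₐ[Fp L] L) : L →+* L) ((gramR L e dV hdV dW hdW).map (algebraMap (Fp L) L)) → ∀ v : HeightOneSpectrum (𝓞 ↥(maximalRealSubfield L)), v.adicCompletion ↥(maximalRealSubfield L))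
    (χq : skewMatrices ((IsCMField.complexConj L : L ≃ₐ[Fp L] L) : L →+* L) ((gramR L e dV hdV dW hdW).map (algebraMap (Fp L) L)) → ∀ v : HeightOneSpectrum (𝓞 ↥(maximalRealSubfield L)), Zg v →* ℂˣ)
    (hχ : ∀ X v z, ((χq X v z : ℂˣ) : ℂ) = ((adeleAddCharAt ↥(maximalRealSubfield L) v (bz X v z * β' X v) : Circle) : ℂ))
    (Λ : ∀ X : skewMatrices ((IsCMField.complexConj L : L ≃ₐ[Fp L] L) : L →+* L) ((gramR L e dV hdV dW hdW).map (algebraMap (Fp L) L)),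
      ι X → HA L e dV hdV dW hdW → ∀ v : HeightOneSpectrum (𝓞 ↥(maximalRealSubfield L)), ↥(SchwartzBruhat (Xsp v)) →ₗ[ℂ] ℂ)
    (hΛ : ∀ X j h v (z : Zg v) (φ' : ↥(SchwartzBruhat (Xsp v))), Λ X j h v (ρ X v z φ') = ((χq X v z : ℂˣ) : ℂ) • Λ X j h v φ')
    (Φ : ∀ X : skewMatrices ((IsCMField.complexConj L : L ≃ₐ[Fp L] L) : L →+* L) ((gramR L e dV hdV dW hdW).map (algebraMap (Fp L) L)),
      ι X → HA L e dV hdV dW hdW → ∀ v : HeightOneSpectrum (𝓞 ↥(maximalRealSubfield L)), ↥(SchwartzBruhat (Xsp v)))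
    (hWfun : ∀ X : skewMatrices ((IsCMField.complexConj L : L ≃ₐ[Fp L] L) : L →+* L) ((gramR L e dV hdV dW hdW).map (algebraMap (Fp L) L)),
      (X : Matrix (Fin n) (Fin n) L) ≠ 0 → (X : Matrix (Fin n) (Fin n) L).det = 0 → ∀ (j : ι X) (h : HA L e dV hdV dW hdW), ∀ v ∈ Tf X,
      W X j h v = cW X j h v * Λ X j h v (Φ X j h v))
    (hfibre : ∀ X : skewMatrices ((IsCMField.complexConj L : L ≃ₐ[Fp L] L) : L →+* L) ((gramR L e dV hdV dW hdW).map (algebraMap (Fp L) L)),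
      (X : Matrix (Fin n) (Fin n) L) ≠ 0 → (X : Matrix (Fin n) (Fin n) L).det = 0 → ∀ v ∈ Tf X,
      ¬ (hilbertSymbol (v.adicCompletion ↥(maximalRealSubfield L)) (algebraMap ↥(maximalRealSubfield L) _ (val X))
          (algebraMap ↥(maximalRealSubfield L) _ (cmQuadraticGenerator L : ↥(maximalRealSubfield L))) = -1 ↔ v ∈ S₁) →
      ∀ x, Gm X v x ≠ β' X v) :
    ∀ X : skewMatrices ((IsCMField.complexConj L : L ≃ₐ[Fp L] L) : L →+* L) ((gramR L e dV hdV dW hdW).map (algebraMap (Fp L) L)),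
      (X : Matrix (Fin n) (Fin n) L) ≠ 0 → (X : Matrix (Fin n) (Fin n) L).det = 0 → ∀ (j : ι X) (h : HA L e dV hdV dW hdW), ∀ v ∈ Tf X,
      ¬ (hilbertSymbol (v.adicCompletion ↥(maximalRealSubfield L)) (algebraMap ↥(maximalRealSubfield L) _ (val X))
          (algebraMap ↥(maximalRealSubfield L) _ (cmQuadraticGenerator L : ↥(maximalRealSubfield L))) = -1 ↔ v ∈ S₁) → W X j h v = 0 := by
  intro X hX0 hdet j h v hv hdead
  rw [hWfun X hX0 hdet j h v hv]
  exact mul_functional_apply_eq_zero_of_forall_ne (adeleAddCharAt ↥(maximalRealSubfield L) v) (exists_adeleAddCharAt_apply_ne_one L v) (ρ X v) (bz X v) (hbz X v)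
    (Gm X v) (β' X v) (hu X v) (hρ X v) (χq X v) (hχ X v) (Λ X j h v) (hΛ X j h v) (hfibre X hX0 hdet v hv hdead) _ _

end Row

/-! ## §3 (ED. 2, append-only) The algebraic road IN THE BALL SLOTS of ★ p863475 ∕ ★ p863507: `V … k := Λ(Φ)` (constant in `k`), `hWfac` with `k₀ = 0`, `hV` by §1

EDITION 2.  The rows heads of record (★ p863475 `hdead_of_facePresentations_rows`, ★ p863507 `hdead_of_packageWitness_rows`, typ4 v12) take row D-2 through the four BALL
slots `cW V hWfac hV`, not through a raw `hbad`.  The algebraic road fills them WITHOUT any ball: take the «ball value» CONSTANT, `V X j h i v k := Λ X j h i v (Φ X j h i v)`;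
then `hWfac` is `hWfun` with threshold `k₀ := 0` and `hV` is §1 (dead place ⇒ `Λ = 0`).  So the tie keeps its slots: `V := fun X j h i v _ => Λ X j h i v (Φ X j h i v)`,
`hWfac := hWfac_faces_of_lineFunctional …`, `hV := hV_faces_of_lineFunctional …`. -/

section BallSlots

variable (L : Type) [Field L] [NumberField L] [IsCMField L]
variable {N M n : ℕ} (e : Fin N × Fin M ≃ Fin n)
  (dV : Fin N → L) (hdV : ∀ i, IsCMField.complexConj L (dV i) = dV i)
  (dW : Fin M → L) (hdW : ∀ i, IsCMField.complexConj L (dW i) = dW i)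

variable {ι : skewMatrices ((IsCMField.complexConj L : L ≃ₐ[Fp L] L) : L →+* L) ((gramR L e dV hdV dW hdW).map (algebraMap (Fp L) L)) → Type}

/-- **`hWfac` SLOT, algebraic road**: with the constant ball value `V … k := Λ(Φ)` the presentation `hWfun : W = cW · Λ(Φ)` IS ★ p863475's `hWfac` binder (threshold `k₀ = 0`).
[cite: KudlaRallis1994, §3] -/
theorem hWfac_faces_of_lineFunctional {φ : Type*}
    (I : ∀ X : skewMatrices ((IsCMField.complexConj L : L ≃ₐ[Fp L] L) : L →+* L) ((gramR L e dV hdV dW hdW).map (algebraMap (Fp L) L)),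
      ι X → HA L e dV hdV dW hdW → Finset φ)
    (Tf : ∀ X : skewMatrices ((IsCMField.complexConj L : L ≃ₐ[Fp L] L) : L →+* L) ((gramR L e dV hdV dW hdW).map (algebraMap (Fp L) L)),
      ι X → HA L e dV hdV dW hdW → Finset (HeightOneSpectrum (𝓞 ↥(maximalRealSubfield L))))
    (W cW : ∀ X : skewMatrices ((IsCMField.complexConj L : L ≃ₐ[Fp L] L) : L →+* L) ((gramR L e dV hdV dW hdW).map (algebraMap (Fp L) L)),
      ι X → HA L e dV hdV dW hdW → φ → HeightOneSpectrum (𝓞 ↥(maximalRealSubfield L)) → ℂ)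
    {Xsp : HeightOneSpectrum (𝓞 ↥(maximalRealSubfield L)) → Type*} [∀ v, TopologicalSpace (Xsp v)]
    (Λ : ∀ X : skewMatrices ((IsCMField.complexConj L : L ≃ₐ[Fp L] L) : L →+* L) ((gramR L e dV hdV dW hdW).map (algebraMap (Fp L) L)),
      ι X → HA L e dV hdV dW hdW → φ → ∀ v : HeightOneSpectrum (𝓞 ↥(maximalRealSubfield L)), ↥(SchwartzBruhat (Xsp v)) →ₗ[ℂ] ℂ)
    (Φ : ∀ X : skewMatrices ((IsCMField.complexConj L : L ≃ₐ[Fp L] L) : L →+* L) ((gramR L e dV hdV dW hdW).map (algebraMap (Fp L) L)),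
      ι X → HA L e dV hdV dW hdW → φ → ∀ v : HeightOneSpectrum (𝓞 ↥(maximalRealSubfield L)), ↥(SchwartzBruhat (Xsp v)))
    (hWfun : ∀ X : skewMatrices ((IsCMField.complexConj L : L ≃ₐ[Fp L] L) : L →+* L) ((gramR L e dV hdV dW hdW).map (algebraMap (Fp L) L)),
      (X : Matrix (Fin n) (Fin n) L) ≠ 0 → (X : Matrix (Fin n) (Fin n) L).det = 0 → ∀ (j : ι X) (h : HA L e dV hdV dW hdW), ∀ i ∈ I X j h, ∀ v ∈ Tf X j h,
      W X j h i v = cW X j h i v * Λ X j h i v (Φ X j h i v)) :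
    ∀ X : skewMatrices ((IsCMField.complexConj L : L ≃ₐ[Fp L] L) : L →+* L) ((gramR L e dV hdV dW hdW).map (algebraMap (Fp L) L)),
      (X : Matrix (Fin n) (Fin n) L) ≠ 0 → (X : Matrix (Fin n) (Fin n) L).det = 0 → ∀ (j : ι X) (h : HA L e dV hdV dW hdW), ∀ i ∈ I X j h, ∀ v ∈ Tf X j h,
      ∃ k₀ : ℕ, ∀ k : ℕ, k₀ ≤ k → W X j h i v = cW X j h i v * (fun (X : skewMatrices ((IsCMField.complexConj L : L ≃ₐ[Fp L] L) : L →+* L) ((gramR L e dV hdV dW hdW).map (algebraMap (Fp L) L)))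
        (j : ι X) (h : HA L e dV hdV dW hdW) (i : φ) (v : HeightOneSpectrum (𝓞 ↥(maximalRealSubfield L))) (_ : ℕ) => Λ X j h i v (Φ X j h i v)) X j h i v k :=
  fun X hX0 hdet j h i hi v hv => ⟨0, fun _ _ => hWfun X hX0 hdet j h i hi v hv⟩

/-- **`hV` SLOT, algebraic road**: with `V … k := Λ(Φ)`, a dead bad place gives `V … k = 0` for all `k ≥ 0` (§1: the quasi-invariant functional vanishes when the Gram misses
the parameter) — ★ p863475's `hV` binder BYTES. [cite: KudlaRallis1994, §3] [cite: Rallis1984, §4] -/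
theorem hV_faces_of_lineFunctional {φ : Type*}
    (S₁ : Finset (HeightOneSpectrum (𝓞 ↥(maximalRealSubfield L))))
    (val : Matrix (Fin n) (Fin n) L → ↥(maximalRealSubfield L))
    (I : ∀ X : skewMatrices ((IsCMField.complexConj L : L ≃ₐ[Fp L] L) : L →+* L) ((gramR L e dV hdV dW hdW).map (algebraMap (Fp L) L)),
      ι X → HA L e dV hdV dW hdW → Finset φ)
    (Tf : ∀ X : skewMatrices ((IsCMField.complexConj L : L ≃ₐ[Fp L] L) : L →+* L) ((gramR L e dV hdV dW hdW).map (algebraMap (Fp L) L)),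
      ι X → HA L e dV hdV dW hdW → Finset (HeightOneSpectrum (𝓞 ↥(maximalRealSubfield L))))
    {Xsp : HeightOneSpectrum (𝓞 ↥(maximalRealSubfield L)) → Type*} [∀ v, TopologicalSpace (Xsp v)] {Zg : HeightOneSpectrum (𝓞 ↥(maximalRealSubfield L)) → Type*} [∀ v, Group (Zg v)]
    (ρ : skewMatrices ((IsCMField.complexConj L : L ≃ₐ[Fp L] L) : L →+* L) ((gramR L e dV hdV dW hdW).map (algebraMap (Fp L) L)) → ∀ v : HeightOneSpectrum (𝓞 ↥(maximalRealSubfield L)), Representation ℂ (Zg v) ↥(SchwartzBruhat (Xsp v)))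
    (bz : skewMatrices ((IsCMField.complexConj L : L ≃ₐ[Fp L] L) : L →+* L) ((gramR L e dV hdV dW hdW).map (algebraMap (Fp L) L)) → ∀ v : HeightOneSpectrum (𝓞 ↥(maximalRealSubfield L)), Zg v → v.adicCompletion ↥(maximalRealSubfield L)) (hbz : ∀ X v t, ∃ z, bz X v z = t)
    (Gm : skewMatrices ((IsCMField.complexConj L : L ≃ₐ[Fp L] L) : L →+* L) ((gramR L e dV hdV dW hdW).map (algebraMap (Fp L) L)) → ∀ v : HeightOneSpectrum (𝓞 ↥(maximalRealSubfield L)), Xsp v → v.adicCompletion ↥(maximalRealSubfield L))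
    (hu : ∀ X v z, IsLocallyConstant fun x => ((adeleAddCharAt ↥(maximalRealSubfield L) v (bz X v z * Gm X v x) : Circle) : ℂ))
    (hρ : ∀ X v (z : Zg v) (φ' : ↥(SchwartzBruhat (Xsp v))),
      ((ρ X v z φ' : ↥(SchwartzBruhat (Xsp v))) : Xsp v → ℂ) = (fun x => ((adeleAddCharAt ↥(maximalRealSubfield L) v (bz X v z * Gm X v x) : Circle) : ℂ)) * φ')
    (β' : skewMatrices ((IsCMField.complexConj L : L ≃ₐ[Fp L] L) : L →+* L) ((gramR L e dV hdV dW hdW).map (algebraMap (Fp L) L)) → ∀ v : HeightOneSpectrum (𝓞 ↥(maximalRealSubfield L)), v.adicCompletion ↥(maximalRealSubfield L))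
    (χq : skewMatrices ((IsCMField.complexConj L : L ≃ₐ[Fp L] L) : L →+* L) ((gramR L e dV hdV dW hdW).map (algebraMap (Fp L) L)) → ∀ v : HeightOneSpectrum (𝓞 ↥(maximalRealSubfield L)), Zg v →* ℂˣ)
    (hχ : ∀ X v z, ((χq X v z : ℂˣ) : ℂ) = ((adeleAddCharAt ↥(maximalRealSubfield L) v (bz X v z * β' X v) : Circle) : ℂ))
    (Λ : ∀ X : skewMatrices ((IsCMField.complexConj L : L ≃ₐ[Fp L] L) : L →+* L) ((gramR L e dV hdV dW hdW).map (algebraMap (Fp L) L)),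
      ι X → HA L e dV hdV dW hdW → φ → ∀ v : HeightOneSpectrum (𝓞 ↥(maximalRealSubfield L)), ↥(SchwartzBruhat (Xsp v)) →ₗ[ℂ] ℂ)
    (hΛ : ∀ X j h i v (z : Zg v) (φ' : ↥(SchwartzBruhat (Xsp v))), Λ X j h i v (ρ X v z φ') = ((χq X v z : ℂˣ) : ℂ) • Λ X j h i v φ')
    (Φ : ∀ X : skewMatrices ((IsCMField.complexConj L : L ≃ₐ[Fp L] L) : L →+* L) ((gramR L e dV hdV dW hdW).map (algebraMap (Fp L) L)),
      ι X → HA L e dV hdV dW hdW → φ → ∀ v : HeightOneSpectrum (𝓞 ↥(maximalRealSubfield L)), ↥(SchwartzBruhat (Xsp v)))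
    (hfibre : ∀ X : skewMatrices ((IsCMField.complexConj L : L ≃ₐ[Fp L] L) : L →+* L) ((gramR L e dV hdV dW hdW).map (algebraMap (Fp L) L)),
      (X : Matrix (Fin n) (Fin n) L) ≠ 0 → (X : Matrix (Fin n) (Fin n) L).det = 0 → ∀ (j : ι X) (h : HA L e dV hdV dW hdW), ∀ v ∈ Tf X j h,
      ¬ (hilbertSymbol (v.adicCompletion ↥(maximalRealSubfield L)) (algebraMap ↥(maximalRealSubfield L) _ (val X))
          (algebraMap ↥(maximalRealSubfield L) _ (cmQuadraticGenerator L : ↥(maximalRealSubfield L))) = -1 ↔ v ∈ S₁) →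
      ∀ x, Gm X v x ≠ β' X v) :
    ∀ X : skewMatrices ((IsCMField.complexConj L : L ≃ₐ[Fp L] L) : L →+* L) ((gramR L e dV hdV dW hdW).map (algebraMap (Fp L) L)),
      (X : Matrix (Fin n) (Fin n) L) ≠ 0 → (X : Matrix (Fin n) (Fin n) L).det = 0 → ∀ (j : ι X) (h : HA L e dV hdV dW hdW), ∀ i ∈ I X j h, ∀ v ∈ Tf X j h,
      ¬ (hilbertSymbol (v.adicCompletion ↥(maximalRealSubfield L)) (algebraMap ↥(maximalRealSubfield L) _ (val X))
          (algebraMap ↥(maximalRealSubfield L) _ (cmQuadraticGenerator L : ↥(maximalRealSubfield L))) = -1 ↔ v ∈ S₁) →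
      ∃ k₁ : ℕ, ∀ k : ℕ, k₁ ≤ k → (fun (X : skewMatrices ((IsCMField.complexConj L : L ≃ₐ[Fp L] L) : L →+* L) ((gramR L e dV hdV dW hdW).map (algebraMap (Fp L) L)))
        (j : ι X) (h : HA L e dV hdV dW hdW) (i : φ) (v : HeightOneSpectrum (𝓞 ↥(maximalRealSubfield L))) (_ : ℕ) => Λ X j h i v (Φ X j h i v)) X j h i v k = 0 := by
  intro X hX0 hdet j h i _ v hv hdead
  refine ⟨0, fun k _ => ?_⟩
  show Λ X j h i v (Φ X j h i v) = 0
  rw [functional_eq_zero_of_forall_ne (adeleAddCharAt ↥(maximalRealSubfield L) v) (exists_adeleAddCharAt_apply_ne_one L v) (ρ X v) (bz X v) (hbz X v)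
    (Gm X v) (β' X v) (hu X v) (hρ X v) (χq X v) (hχ X v) (Λ X j h i v) (hΛ X j h i v) (hfibre X hX0 hdet j h v hv hdead), LinearMap.zero_apply]

end BallSlots

end Summit.HodgeConjecture.HodgeConjecture.Cruxes.HLiu418.K2LiuIncoherentRankOneBadPlaceFunctionalRow

end
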